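import Literature.AlgebraicGeometry.Modules.KernelFiniteLocallyFree
import Literature.AlgebraicGeometry.Modules.FiniteType
import HarnessLib

/-!
# [OURS · L1 W4.5(b) · S6 (L) brick C2, B3-assembly side input (S3)] A locally split quotient of finite locally free modules
# is finite locally free

Cell `res-hironaka`, LADDER-RESOLUTION rung L (D-0089), slot W4.5(b), crux chain w45b: working crux
`Theses.EquisingularLift.EquisingularLiftNat` (stmt-ResolutionOfSingularities-20038) / child `EquisingularLiftNatThree`
(stmt-ResolutionOfSingularities-20148); brick C2 of res-L1-w45b-stub-4's `Tower.hLift_of_bricks` (socket `stub_elnat_three_liftSections`):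
the input `hQf : IsFiniteLocallyFree (cokernel ι₀)` of res-L1-w45b-lead-2's B3 assembly `subsingleton_cechMH1_sheafHom_Dplus_of_dirStepUnobs`
and of stub-4's call site (GLUE CUT, STATUS l.77725), dealt BY SIGNATURE to res-L1-w45b-stub-2 g9 (lead-2 (S3) l.77716, desk l.77727: one
object = (S3) + the cokernel corollary in ONE module). `--supports stmt-ResolutionOfSingularities-20148 --as helper`. OURS; NOT a statement of any
manuscript; AI-written, and AI review is weaker than expert review. No `sorry`, standard axioms, DEF-FREE.

WHAT.
* **`isFiniteLocallyFree_X₃_of_retraction`** — for a short exact `0 → X₁ → X₂ → X₃ → 0` of `𝒪_X`-modules with `X₁`, `X₂` finite locally free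
  and `X₁ → X₂` LOCALLY SPLIT (near every point a retraction `r : X₂|_W → X₁|_W`, `f|_W ≫ r = 𝟙` — the `hsplit` clause of C1b
  `P1VB.exists_subLineBundle_of_proportional` / T-P1VB verbatim), `X₃` is finite locally free. Proof (engine of the tree's Stacks 05P2 file
  `Modules/KernelFiniteLocallyFree`, second half verbatim): on a small affine `V ∋ x` inside `W` and a frame of `X₂`, `Γ(X₂, V)` is free of
  finite rank; `Γ(X₂, V) → Γ(X₃, V)` is onto (`X₁` quasi-coherent, tree `app_surjective_of_shortExact`) with kernel the image of `Γ(X₁, V)`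
  (left exactness of sections), and `s ↦ s − f(r(s))` descends to a linear section of it, so `Γ(X₃, V)` is finite projective
  (`Module.Projective.of_split`); `X₃` is affine-localizing (`IsAffineLocalizing.of_shortExact₃`), hence free on a basic open `D(r) ∋ x`
  (`exists_basis_localizedModule_away`, `nonempty_basis_sections_basicOpen`, `nonempty_free_iso_over_of_basis`).
* **`isFiniteLocallyFree_cokernel_of_locallySplit`** — the same for `cokernel ι` of a locally split monomorphism `ι : L ⟶ F` between finite
  locally free modules (stub-4's spelling; `S := L → F → cokernel ι`).

References (index only): The Stacks Project, Tags 05P2, 00NX [cite: StacksProject]; R. Hartshorne, *Algebraic Geometry* (1977), II Prop. 5.6–5.7,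
II Ex. 5.7 [cite: Hartshorne1977].
-/

noncomputable section

-- `TopCat.Presheaf`/`Scheme.Modules` are not reducible (as in Mathlib's `AlgebraicGeometry/Modules`).
set_option backward.isDefEq.respectTransparency false

open CategoryTheory CategoryTheory.Limits AlgebraicGeometry TopologicalSpace Opposite
open Literature.AlgebraicGeometry.Modules Literature.AlgebraicGeometry.Motives

set_option linter.dupNamespace false -- mandated namespace `Summit.<Summit>.<Problem>` of this single-conjunct summit

namespace Summit.ResolutionOfSingularities.ResolutionOfSingularities.Cruxes.EquisingularLiftNat.Sections

universe u

/-- **A locally split quotient of finite locally free modules is finite locally free** (S3): `0 → X₁ → X₂ → X₃ → 0` short exact, `X₁`, `X₂`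
finite locally free, `X₁ → X₂` with a retraction near every point ⇒ `X₃` finite locally free. [cite: StacksProject, Tags 05P2 and 00NX] -/
theorem isFiniteLocallyFree_X₃_of_retraction {X : Scheme.{u}} {S : ShortComplex X.Modules} (hS : S.ShortExact)
    (h₁ : IsFiniteLocallyFree S.X₁) (h₂ : IsFiniteLocallyFree S.X₂)
    (hsplit : ∀ x : X, ∃ (W : X.Opens) (_ : x ∈ W) (r : S.X₂.over W ⟶ S.X₁.over W),
      (SheafOfModules.overFunctor _ W).map S.f ≫ r = 𝟙 _) :
    IsFiniteLocallyFree S.X₃ := by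
  classical
  intro x
  obtain ⟨W, hxW, r, hr⟩ := hsplit x
  -- a frame of `X₂` near `x`, and an affine open `V ∋ x` inside both
  obtain ⟨U, hxU, I, hI, ⟨eE⟩⟩ := h₂ x
  obtain ⟨V, hV, hxV, hVle⟩ := Opens.isBasis_iff_nbhd.mp X.isBasis_affineOpens (show x ∈ W ⊓ U from ⟨hxW, hxU⟩)
  have hVW : V ≤ W := hVle.trans inf_le_left
  have hVU : V ≤ U := hVle.trans inf_le_right
  -- `Γ(X₂, V)` is free of finite rank over `B = Γ(X, V)`
  let eV : SheafOfModules.free I ≅ S.X₂.over V := SheafOfModules.restrictTrivialisation (R := X.ringCatSheaf) (homOfLE hVU) eE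
  haveI := Fintype.ofFinite I
  obtain ⟨bE⟩ := nonempty_basis_of_frame eV
  haveI : Module.Free Γ(X, V) Γ(S.X₂, V) := Module.Free.of_basis bE
  haveI : Module.Finite Γ(X, V) Γ(S.X₂, V) := Module.Finite.of_basis bE
  -- the three `B`-linear maps on sections over `V`
  let fL : Γ(S.X₁, V) →ₗ[Γ(X, V)] Γ(S.X₂, V) := appLinear S.f V
  let gL : Γ(S.X₂, V) →ₗ[Γ(X, V)] Γ(S.X₃, V) := appLinear S.g V
  let rL : Γ(S.X₂, V) →ₗ[Γ(X, V)] Γ(S.X₁, V) :=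
    { toFun := fun s => appLE r (homOfLE hVW) s
      map_add' := fun s t => appLE_add_right r (homOfLE hVW) s t
      map_smul' := fun a s => appLE_smul_right r (homOfLE hVW) a s }
  have hrf : ∀ s, rL (fL s) = s := by
    intro s
    have h := congrArg (fun φ => appLE φ (homOfLE hVW) s) hr
    rw [appLE_comp, appLE_over_map, appLE_id] at h
    exact h
  have hgf : ∀ s, gL (fL s) = 0 := fun s => app_app_eq_zero S V s
  -- quasi-coherence
  haveI := h₁.isVectorBundle.1
  haveI := h₂.isVectorBundle.1
  have h₁loc : IsAffineLocalizing S.X₁ := IsAffineLocalizing.of_isQuasicoherent S.X₁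
  have h₂loc : IsAffineLocalizing S.X₂ := IsAffineLocalizing.of_isQuasicoherent S.X₂
  have h₃loc : IsAffineLocalizing S.X₃ := IsAffineLocalizing.of_shortExact₃ hS h₁loc h₂loc
  -- `Γ(X₂, V) → Γ(X₃, V)` is onto with kernel the image of `Γ(X₁, V)`; `s ↦ s - f (r s)` descends to a section of it
  have hsurj : Function.Surjective gL := Literature.AlgebraicGeometry.Morphisms.app_surjective_of_shortExact hS h₁loc hV
  have hker : LinearMap.ker gL ≤ LinearMap.ker (LinearMap.id - fL.comp rL) := by
    intro m hm
    obtain ⟨m', rfl⟩ := (sections_exact_of_shortExact hS V).2 m hm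
    change (fL m' : Γ(S.X₂, V)) - fL (rL (fL m')) = 0
    rw [hrf, sub_self]
  let sL : Γ(S.X₃, V) →ₗ[Γ(X, V)] Γ(S.X₂, V) :=
    ((LinearMap.ker gL).liftQ (LinearMap.id - fL.comp rL) hker).comp (gL.quotKerEquivOfSurjective hsurj).symm.toLinearMap
  have hsec : gL.comp sL = LinearMap.id := by
    ext p
    obtain ⟨m, rfl⟩ := hsurj p
    have hq : (gL.quotKerEquivOfSurjective hsurj).symm (gL m) = Submodule.Quotient.mk m := by
      rw [LinearEquiv.symm_apply_eq, LinearMap.quotKerEquivOfSurjective_apply_mk]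
    change gL (((LinearMap.ker gL).liftQ (LinearMap.id - fL.comp rL) hker) ((gL.quotKerEquivOfSurjective hsurj).symm (gL m))) = gL m
    rw [hq, Submodule.liftQ_apply]
    change gL (m - fL (rL m)) = gL m
    rw [map_sub, hgf, sub_zero]
  haveI : Module.Projective Γ(X, V) Γ(S.X₃, V) := Module.Projective.of_split sL gL hsec
  haveI : Module.Finite Γ(X, V) Γ(S.X₃, V) := Module.Finite.of_surjective gL hsurj
  -- the prime of `x` in `B` and a basic open `D(t) ∋ x` on which `Γ(X₃, V)_t` is free
  obtain ⟨t, ht, ι', hι', ⟨b⟩⟩ := exists_basis_localizedModule_away Γ(S.X₃, V) (hV.primeIdealOf ⟨x, hxV⟩).asIdeal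
  have hxD : x ∈ X.basicOpen t := (mem_basicOpen_iff_not_mem_primeIdealOf hV t hxV).mpr ht
  obtain ⟨bD⟩ := nonempty_basis_sections_basicOpen h₃loc hV t b
  obtain ⟨iso⟩ := nonempty_free_iso_over_of_basis S.X₃ h₃loc (hV.basicOpen t) bD
  exact ⟨X.basicOpen t, hxD, ι', hι', ⟨iso⟩⟩

/-- **The cokernel of a locally split monomorphism between finite locally free modules is finite locally free** (stub-4's spelling of (S3),
`S := L → F → cokernel ι`). [cite: StacksProject, Tags 05P2 and 00NX] -/
theorem isFiniteLocallyFree_cokernel_of_locallySplit {X : Scheme.{u}} {L F : X.Modules} (ι : L ⟶ F) [Mono ι]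
    (hL : IsFiniteLocallyFree L) (hF : IsFiniteLocallyFree F)
    (hsplit : ∀ x : X, ∃ (W : X.Opens) (_ : x ∈ W) (r : F.over W ⟶ L.over W), (SheafOfModules.overFunctor _ W).map ι ≫ r = 𝟙 _) :
    IsFiniteLocallyFree (cokernel ι) :=
  have hS : (ShortComplex.mk ι (cokernel.π ι) (cokernel.condition ι)).ShortExact :=
    ShortComplex.ShortExact.mk' (ShortComplex.exact_cokernel ι) inferInstance inferInstance
  isFiniteLocallyFree_X₃_of_retraction hS hL hF hsplit

end Summit.ResolutionOfSingularities.ResolutionOfSingularities.Cruxes.EquisingularLiftNat.Sections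

end
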